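import Literature.NumberTheory.Sieve.SmoothArcClassUniformityFibre
import Literature.NumberTheory.Sieve.SmoothParityMajorArcsPrep
import HarnessLib

/-!
# Major-arc cancellation between unit-class configurations: lemmas

Topic `Literature/NumberTheory/Sieve`, namespace `Literature.NumberTheory.Sieve.SmoothArcs`; a PROVED tool file of the
circle-method engine behind [MontgomeryVaughanActa1975, §5–6] and [Harper2016, §5], sequel of
`SmoothArcClassUniformityFibre` (the fibrewise class-uniformity identity) and `SmoothParityMajorArcsPrep` (the major
arcs `{r < N₀ : ‖r/N₀ − a/k‖ ≤ ρ}` on `N₀` sample points, `‖·‖ = distInt`).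

Setting: an odd prime `q`, `N₀ = qN₁` sample points, a level `k ≥ 1`, and on the arc at `a/k` (`(a, k) = 1`) the PURE
PRINCIPAL product of a ternary problem `d₁n₁ ± d₂n₂ = d₃n₃` with `n₁ ≡ c₁`, `n₂ ≡ c₂ (mod 2q)` in unit classes:
`classWeightedSum (W₁ a r) (2q) c₁ k (D₁q^v a) · classWeightedSum (W₂ a r) (2q) c₂ k (D₂a) · conj (classWeightedSum (W₃ a r) m r₃ k (D₃a))`
(`v ≥ 1`, `q ∤ D₂`, `q ∤ m`), whose gcd-weights `W_i a r` may depend on the sample point `r` of the arc (through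
`β = r/N₀ − a/k`).  Main results:

* `sum_coprime_sum_filter_eq_sum_fibre` (ORBIT DECOMPOSITION, abstract): for `k = qk'`, data `F(a, r, b)` and an arc
  predicate `A(a, r)` invariant under the `ℤ/q`-shift `(a, r) ↦ (a + ik', r + iN₁ mod N₀)`,
  `Σ_{a<k,(a,k)=1} Σ_{r<N₀, A(a,r)} F(a,r,a) = Σ_{a₂<k'} Σ_{r<N₀, A(a₂,r)} Σ_{b in the fibre of a₂} F(a₂,r,b)`
  (split `a = a₂ + ik'`, shift `r` back by `iN₁` on each fibre);
* `distInt_shift_eq`: the arcs are shift invariant (`(r + iN₁)/N₀ − (a + ik')/k = r/N₀ − a/k`);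
* `sum_coprime_sum_arc_principal_eq` (THE PRINCIPAL `k`-TOTALS ARE CLASS INDEPENDENT): for every `k ≥ 1`, weights that
  are shift invariant when `q ∣ k`, and two unit-class configurations `(c₁, c₂)`, `(c₁', c₂')`:
  `Σ_{(a,k)=1} Σ_{r ∈ arc(k,a)} (principal product)` agrees for the two configurations — pointwise for `q ∤ k`
  (`classWeightedSum_mul_mul_conj_eq_of_not_dvd`), identically zero for `q² ∣ k`, and for `q ∥ k` fibre by fibre after
  the orbit decomposition (`sum_coprime_sum_filter_classWeightedSum_mul_mul_eq`), by `sum_fibre_classWeightedSum_mul_mul_eq`;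
* `norm_triple_conj_sub_le`: the telescoping bound `‖V₁V₂V̄₃ − P₁P₂P̄₃‖ ≤ E₁B₂B₃ + B₁E₂B₃ + B₁B₂E₃`.

The summation over the major arcs is in `SmoothCEMajorArcs`.

## References

* H. L. Montgomery, R. C. Vaughan, Acta Arith. 27 (1975), §5–6 [MontgomeryVaughanActa1975].
* A. J. Harper, Compositio Math. 152 (2016), §5 [Harper2016].
-/

noncomputable section

open Finset Real Complex

namespace Literature.NumberTheory.Sieve

namespace SmoothArcs

open Vinogradov

/-! ### The `ℤ/q`-orbit decomposition -/

/-- **Orbit decomposition of an arc double sum under the `ℤ/q`-shift.** Let `k = qk'`, `N₀ = qN₁`, and let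
`F : ℕ → ℕ → ℕ → ℂ` and the predicate `A` be invariant under `(a, r) ↦ (a + ik', (r + iN₁) mod N₀)` for `a < k'`,
`i < q`, `r < N₀`.  Then
`Σ_{a < k, (a,k)=1} Σ_{r < N₀, A(a,r)} F(a, r, a) = Σ_{a₂ < k'} Σ_{r < N₀, A(a₂,r)} Σ_{b < k, (b,k)=1, b ≡ a₂ (k')} F(a₂, r, b)`:
split `a = a₂ + ik'` (`a₂ = a mod k'`, `i = ⌊a/k'⌋ < q`) and translate `r` by `iN₁` on each fibre. [folklore] -/
theorem sum_coprime_sum_filter_eq_sum_fibre {q k' N₁ : ℕ} (F : ℕ → ℕ → ℕ → ℂ) (A : ℕ → ℕ → Prop)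
    [∀ a, DecidablePred (A a)]
    (hF : ∀ a < k', ∀ i < q, ∀ r < q * N₁, ∀ b, F (a + i * k') ((r + i * N₁) % (q * N₁)) b = F a r b)
    (hA : ∀ a < k', ∀ i < q, ∀ r < q * N₁, A (a + i * k') ((r + i * N₁) % (q * N₁)) ↔ A a r) :
    ∑ a ∈ (Finset.range (q * k')).filter (Nat.Coprime (q * k')),
        ∑ r ∈ (Finset.range (q * N₁)).filter (A a), F a r a =
      ∑ a₂ ∈ Finset.range k', ∑ r ∈ (Finset.range (q * N₁)).filter (A a₂),
        ∑ b ∈ (Finset.range (q * k')).filter (fun b => Nat.Coprime (q * k') b ∧ b ≡ a₂ [MOD k']), F a₂ r b := by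
  rcases Nat.eq_zero_or_pos k' with rfl | hk'
  · simp
  rcases Nat.eq_zero_or_pos N₁ with rfl | hN₁
  · simp
  have hmaps : ∀ a ∈ (Finset.range (q * k')).filter (Nat.Coprime (q * k')), a % k' ∈ Finset.range k' :=
    fun a _ => Finset.mem_range.mpr (Nat.mod_lt a hk')
  rw [← Finset.sum_fiberwise_of_maps_to hmaps]
  refine Finset.sum_congr rfl fun a₂ ha₂ => ?_
  have ha₂ : a₂ < k' := Finset.mem_range.mp ha₂
  have hfib : ((Finset.range (q * k')).filter (Nat.Coprime (q * k'))).filter (fun a => a % k' = a₂) =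
      (Finset.range (q * k')).filter (fun b => Nat.Coprime (q * k') b ∧ b ≡ a₂ [MOD k']) := by
    rw [Finset.filter_filter]
    refine Finset.filter_congr fun b _ => ?_
    rw [Nat.ModEq, Nat.mod_eq_of_lt ha₂]
  have key : ∀ b ∈ (Finset.range (q * k')).filter (fun b => Nat.Coprime (q * k') b ∧ b ≡ a₂ [MOD k']),
      ∑ r ∈ (Finset.range (q * N₁)).filter (A b), F b r b =
        ∑ r ∈ Finset.range (q * N₁), if A a₂ r then F a₂ r b else 0 := by
    intro b hb
    obtain ⟨hbk, -, hba⟩ := Finset.mem_filter.mp hb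
    have hbk : b < q * k' := Finset.mem_range.mp hbk
    obtain ⟨i, hiq, rfl⟩ : ∃ i, i < q ∧ b = a₂ + i * k' := by
      refine ⟨b / k', (Nat.div_lt_iff_lt_mul hk').mpr hbk, ?_⟩
      have h1 := Nat.mod_add_div b k'
      rw [Nat.ModEq, Nat.mod_eq_of_lt ha₂] at hba
      rw [hba, mul_comm] at h1
      exact h1.symm
    have hiN : i * N₁ < q * N₁ := Nat.mul_lt_mul_of_pos_right hiq hN₁
    rw [Finset.sum_filter, ← sum_range_comp_add_mod hiN
      (fun r => if A (a₂ + i * k') r then F (a₂ + i * k') r (a₂ + i * k') else 0)]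
    refine Finset.sum_congr rfl fun r hr => ?_
    have hr : r < q * N₁ := Finset.mem_range.mp hr
    have eA := hA a₂ ha₂ i hiq r hr
    by_cases hAr : A a₂ r
    · rw [if_pos (eA.mpr hAr), if_pos hAr, hF a₂ ha₂ i hiq r hr]
    · rw [if_neg (fun h => hAr (eA.mp h)), if_neg hAr]
  rw [hfib, Finset.sum_congr rfl key, Finset.sum_comm, Finset.sum_filter]
  refine Finset.sum_congr rfl fun r _ => ?_
  by_cases hAr : A a₂ r
  · simp only [if_pos hAr]
  · simp only [if_neg hAr, Finset.sum_const_zero]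

/-! ### Shift invariance of the arcs -/

/-- **The arcs are shift invariant**: for `q, k', N₁ ≥ 1`,
`‖((r + iN₁) mod qN₁)/(qN₁) − (a + ik')/(qk')‖ = ‖r/(qN₁) − a/(qk')‖` (the two shifts are both `i/q`, up to an
integer). [folklore] -/
theorem distInt_shift_eq {q k' N₁ : ℕ} (hq : 0 < q) (hk' : 0 < k') (hN₁ : 0 < N₁) (a r i : ℕ) :
    distInt ((((r + i * N₁) % (q * N₁) : ℕ) : ℝ) / ((q * N₁ : ℕ) : ℝ) - ((a + i * k' : ℕ) : ℝ) / ((q * k' : ℕ) : ℝ)) =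
      distInt ((r : ℝ) / ((q * N₁ : ℕ) : ℝ) - (a : ℝ) / ((q * k' : ℕ) : ℝ)) := by
  have hq0 : (q : ℝ) ≠ 0 := by positivity
  have hk0 : (k' : ℝ) ≠ 0 := by positivity
  have hN0 : (N₁ : ℝ) ≠ 0 := by positivity
  set n : ℕ := (r + i * N₁) / (q * N₁) with hn
  have hmod : (((r + i * N₁) % (q * N₁) : ℕ) : ℝ) = ((r + i * N₁ : ℕ) : ℝ) - ((q * N₁ : ℕ) : ℝ) * n := by
    have h1 : (r + i * N₁) % (q * N₁) + q * N₁ * n = r + i * N₁ := Nat.mod_add_div _ _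
    have e : (((r + i * N₁) % (q * N₁) : ℕ) : ℝ) + ((q * N₁ : ℕ) : ℝ) * n = ((r + i * N₁ : ℕ) : ℝ) := by
      exact_mod_cast h1
    linarith
  have key : (((r + i * N₁) % (q * N₁) : ℕ) : ℝ) / ((q * N₁ : ℕ) : ℝ) - ((a + i * k' : ℕ) : ℝ) / ((q * k' : ℕ) : ℝ) =
      ((r : ℝ) / ((q * N₁ : ℕ) : ℝ) - (a : ℝ) / ((q * k' : ℕ) : ℝ)) + ((-(n : ℤ) : ℤ) : ℝ) := by
    rw [hmod]
    push_cast
    field_simp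
    ring
  rw [key, distInt_add_int]

/-! ### The principal `k`-totals are class independent -/

/-- **`q ∤ k`: pointwise class independence.** For an odd prime `q`, `q ∤ k`, `v ≥ 1`, `q ∤ D₂`, `q ∤ m`, a unit
`a < k` and unit classes `c₁, c₂, c₁', c₂' (mod 2q)`, the principal product
`classWeightedSum W₁ (2q) c₁ k (D₁q^v a) · classWeightedSum W₂ (2q) c₂ k (D₂a) · conj (classWeightedSum W₃ m r₃ k (D₃a))`
is the same for `(c₁, c₂)` and `(c₁', c₂')` (the fibre of `a` at `j = 0` is `{a}`). [folklore] -/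
theorem classWeightedSum_mul_mul_conj_eq_of_not_dvd {q k : ℕ} (hq : q.Prime) (hq2 : q ≠ 2) (hqk : ¬ q ∣ k)
    {v : ℕ} (hv : 1 ≤ v) (D₁ : ℤ) {D₂ : ℤ} (hD₂ : ¬ (q : ℤ) ∣ D₂) (D₃ : ℤ) (W₁ W₂ W₃ : ℕ → ℂ) {m : ℕ}
    (hm : ¬ q ∣ m) (r₃ : ℕ) {c₁ c₂ c₁' c₂' : ℕ} (hc₁ : c₁.Coprime (2 * q)) (hc₂ : c₂.Coprime (2 * q))
    (hc₁' : c₁'.Coprime (2 * q)) (hc₂' : c₂'.Coprime (2 * q)) {a : ℕ} (ha : a < k) (hka : Nat.Coprime k a) :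
    classWeightedSum W₁ (2 * q) c₁ k (D₁ * q ^ v * a) * classWeightedSum W₂ (2 * q) c₂ k (D₂ * a) *
        starRingEnd ℂ (classWeightedSum W₃ m r₃ k (D₃ * a)) =
      classWeightedSum W₁ (2 * q) c₁' k (D₁ * q ^ v * a) * classWeightedSum W₂ (2 * q) c₂' k (D₂ * a) *
        starRingEnd ℂ (classWeightedSum W₃ m r₃ k (D₃ * a)) := by
  have hk : k ≠ 0 := by rintro rfl; exact hqk (dvd_zero q)
  have hset : (Finset.range k).filter (fun b => Nat.Coprime k b ∧ b ≡ a [MOD k]) = {a} := by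
    ext b
    simp only [Finset.mem_filter, Finset.mem_range, Finset.mem_singleton]
    constructor
    · rintro ⟨hb, -, hba⟩
      rwa [Nat.ModEq, Nat.mod_eq_of_lt hb, Nat.mod_eq_of_lt ha] at hba
    · rintro rfl
      exact ⟨ha, hka, Nat.ModEq.refl b⟩
  have h := sum_fibre_classWeightedSum_mul_mul_eq (j := 0) hq hq2 hk hqk hv D₁ hD₂ (-D₃) W₁ W₂
    (fun g => starRingEnd ℂ (W₃ g)) hm r₃ hc₁ hc₂ hc₁' hc₂' a
  simp only [pow_zero, one_mul] at h
  rw [hset, Finset.sum_singleton, Finset.sum_singleton] at h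
  rw [conj_classWeightedSum, ← neg_mul]
  exact h

/-- **`q ∥ k`: class independence after the orbit decomposition.** For an odd prime `q`, `k = qk'` with `q ∤ k'`,
`N₀ = qN₁`, `v ≥ 1`, `q ∤ D₂`, `q ∤ m`, weights `W_i a r` and an arc predicate `A` invariant under the shift
`(a, r) ↦ (a + ik', (r + iN₁) mod N₀)`, and unit classes mod `2q`:
`Σ_{a<k,(a,k)=1} Σ_{r<N₀, A(a,r)} classWeightedSum (W₁ a r) (2q) c₁ k (D₁q^v a) · classWeightedSum (W₂ a r) (2q) c₂ k (D₂a) · conj (classWeightedSum (W₃ a r) m r₃ k (D₃a))`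
is the same for `(c₁, c₂)` and `(c₁', c₂')`: by `sum_coprime_sum_filter_eq_sum_fibre` it is a sum of fibre sums with
FIXED weights, to which `sum_fibre_classWeightedSum_mul_mul_eq` applies. [folklore] -/
theorem sum_coprime_sum_filter_classWeightedSum_mul_mul_eq {q k' N₁ : ℕ} (hq : q.Prime) (hq2 : q ≠ 2)
    (hqk' : ¬ q ∣ k') {v : ℕ} (hv : 1 ≤ v) (D₁ : ℤ) {D₂ : ℤ} (hD₂ : ¬ (q : ℤ) ∣ D₂) (D₃ : ℤ) {m : ℕ}
    (hm : ¬ q ∣ m) (r₃ : ℕ) (W₁ W₂ W₃ : ℕ → ℕ → ℕ → ℂ) (A : ℕ → ℕ → Prop) [∀ a, DecidablePred (A a)]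
    (hW : ∀ a < k', ∀ i < q, ∀ r < q * N₁,
      W₁ (a + i * k') ((r + i * N₁) % (q * N₁)) = W₁ a r ∧ W₂ (a + i * k') ((r + i * N₁) % (q * N₁)) = W₂ a r ∧
        W₃ (a + i * k') ((r + i * N₁) % (q * N₁)) = W₃ a r)
    (hA : ∀ a < k', ∀ i < q, ∀ r < q * N₁, A (a + i * k') ((r + i * N₁) % (q * N₁)) ↔ A a r)
    {c₁ c₂ c₁' c₂' : ℕ} (hc₁ : c₁.Coprime (2 * q)) (hc₂ : c₂.Coprime (2 * q)) (hc₁' : c₁'.Coprime (2 * q))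
    (hc₂' : c₂'.Coprime (2 * q)) :
    ∑ a ∈ (Finset.range (q * k')).filter (Nat.Coprime (q * k')), ∑ r ∈ (Finset.range (q * N₁)).filter (A a),
        classWeightedSum (W₁ a r) (2 * q) c₁ (q * k') (D₁ * q ^ v * a) *
          classWeightedSum (W₂ a r) (2 * q) c₂ (q * k') (D₂ * a) *
            starRingEnd ℂ (classWeightedSum (W₃ a r) m r₃ (q * k') (D₃ * a)) =
      ∑ a ∈ (Finset.range (q * k')).filter (Nat.Coprime (q * k')), ∑ r ∈ (Finset.range (q * N₁)).filter (A a),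
        classWeightedSum (W₁ a r) (2 * q) c₁' (q * k') (D₁ * q ^ v * a) *
          classWeightedSum (W₂ a r) (2 * q) c₂' (q * k') (D₂ * a) *
            starRingEnd ℂ (classWeightedSum (W₃ a r) m r₃ (q * k') (D₃ * a)) := by
  rcases Nat.eq_zero_or_pos k' with rfl | hk'
  · simp
  -- the principal product with the conjugation moved into the weights
  set F : ℕ → ℕ → ℕ → ℕ → ℕ → ℂ := fun s₁ s₂ a r b =>
    classWeightedSum (W₁ a r) (2 * q) s₁ (q * k') (D₁ * q ^ v * b) *
      classWeightedSum (W₂ a r) (2 * q) s₂ (q * k') (D₂ * b) *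
        classWeightedSum (fun g => starRingEnd ℂ (W₃ a r g)) m r₃ (q * k') (-D₃ * b) with hF
  have hconj : ∀ s₁ s₂ a r, classWeightedSum (W₁ a r) (2 * q) s₁ (q * k') (D₁ * q ^ v * a) *
      classWeightedSum (W₂ a r) (2 * q) s₂ (q * k') (D₂ * a) *
        starRingEnd ℂ (classWeightedSum (W₃ a r) m r₃ (q * k') (D₃ * a)) = F s₁ s₂ a r a := by
    intro s₁ s₂ a r
    rw [hF, conj_classWeightedSum, ← neg_mul]
  have hFs : ∀ s₁ s₂, ∀ a < k', ∀ i < q, ∀ r < q * N₁, ∀ b,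
      F s₁ s₂ (a + i * k') ((r + i * N₁) % (q * N₁)) b = F s₁ s₂ a r b := by
    intro s₁ s₂ a ha i hi r hr b
    obtain ⟨h1, h2, h3⟩ := hW a ha i hi r hr
    simp only [hF, h1, h2, h3]
  simp_rw [hconj]
  rw [sum_coprime_sum_filter_eq_sum_fibre (F c₁ c₂) A (hFs c₁ c₂) hA,
    sum_coprime_sum_filter_eq_sum_fibre (F c₁' c₂') A (hFs c₁' c₂') hA]
  refine Finset.sum_congr rfl fun a _ => Finset.sum_congr rfl fun r _ => ?_
  have h := sum_fibre_classWeightedSum_mul_mul_eq (j := 1) hq hq2 hk'.ne' hqk' hv D₁ hD₂ (-D₃) (W₁ a r) (W₂ a r)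
    (fun g => starRingEnd ℂ (W₃ a r g)) hm r₃ hc₁ hc₂ hc₁' hc₂' a
  simp only [pow_one] at h
  exact h

/-- **The principal `k`-totals over the arcs are class independent.** For an odd prime `q`, `N₀ = qN₁`, a level
`k`, `v ≥ 1`, `q ∤ D₂`, `q ∤ m`, `ρ ∈ ℝ`, weights `W_i a r` that are invariant under the offset shift
`(a, r) ↦ ((a + i·k/q) mod k, (r + iN₁) mod N₀)` whenever `q ∣ k`, and unit classes `c₁, c₂, c₁', c₂' (mod 2q)`:
`Σ_{a<k,(a,k)=1} Σ_{r<N₀, ‖r/N₀ − a/k‖ ≤ ρ} classWeightedSum (W₁ a r) (2q) c₁ k (D₁q^v a) · classWeightedSum (W₂ a r) (2q) c₂ k (D₂a) · conj (classWeightedSum (W₃ a r) m r₃ k (D₃a))`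
takes the same value for `(c₁, c₂)` and `(c₁', c₂')` — pointwise if `q ∤ k`, termwise zero if `q² ∣ k`
(`classWeightedSum_eq_zero_of_sq_dvd_of_coprime`), and by the orbit decomposition if `q ∥ k`. [folklore] -/
theorem sum_coprime_sum_arc_principal_eq {q N₀ N₁ k : ℕ} (hq : q.Prime) (hq2 : q ≠ 2) (hN : N₀ = q * N₁)
    {v : ℕ} (hv : 1 ≤ v) (ρ : ℝ) (D₁ : ℤ) {D₂ : ℤ} (hD₂ : ¬ (q : ℤ) ∣ D₂) (D₃ : ℤ) {m : ℕ} (hm : ¬ q ∣ m)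
    (r₃ : ℕ) (W₁ W₂ W₃ : ℕ → ℕ → ℕ → ℂ)
    (hW : q ∣ k → ∀ a < k, ∀ r < N₀, ∀ i < q,
      W₁ ((a + i * (k / q)) % k) ((r + i * N₁) % N₀) = W₁ a r ∧
        W₂ ((a + i * (k / q)) % k) ((r + i * N₁) % N₀) = W₂ a r ∧
          W₃ ((a + i * (k / q)) % k) ((r + i * N₁) % N₀) = W₃ a r)
    {c₁ c₂ c₁' c₂' : ℕ} (hc₁ : c₁.Coprime (2 * q)) (hc₂ : c₂.Coprime (2 * q)) (hc₁' : c₁'.Coprime (2 * q))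
    (hc₂' : c₂'.Coprime (2 * q)) :
    ∑ a ∈ (Finset.range k).filter (Nat.Coprime k),
        ∑ r ∈ (Finset.range N₀).filter (fun r : ℕ => distInt ((r : ℝ) / N₀ - (a : ℝ) / k) ≤ ρ),
          classWeightedSum (W₁ a r) (2 * q) c₁ k (D₁ * q ^ v * a) *
            classWeightedSum (W₂ a r) (2 * q) c₂ k (D₂ * a) *
              starRingEnd ℂ (classWeightedSum (W₃ a r) m r₃ k (D₃ * a)) =
      ∑ a ∈ (Finset.range k).filter (Nat.Coprime k),
        ∑ r ∈ (Finset.range N₀).filter (fun r : ℕ => distInt ((r : ℝ) / N₀ - (a : ℝ) / k) ≤ ρ),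
          classWeightedSum (W₁ a r) (2 * q) c₁' k (D₁ * q ^ v * a) *
            classWeightedSum (W₂ a r) (2 * q) c₂' k (D₂ * a) *
              starRingEnd ℂ (classWeightedSum (W₃ a r) m r₃ k (D₃ * a)) := by
  by_cases hqk : q ∣ k
  · by_cases hqk2 : q ^ 2 ∣ k
    · -- every summand vanishes
      have hz : ∀ (s₁ : ℕ) {s₂ : ℕ}, s₂.Coprime (2 * q) → ∀ a ∈ (Finset.range k).filter (Nat.Coprime k),
          ∀ (r : ℕ) (Φ : ℂ), classWeightedSum (W₁ a r) (2 * q) s₁ k (D₁ * q ^ v * a) *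
            classWeightedSum (W₂ a r) (2 * q) s₂ k (D₂ * a) * Φ = 0 := by
        intro s₁ s₂ hs₂ a ha r Φ
        rw [classWeightedSum_eq_zero_of_sq_dvd_of_coprime hq hq2 hqk2 (hs₂.coprime_dvd_right (dvd_mul_left q 2))
          hD₂ (Finset.mem_filter.mp ha).2 (W₂ a r), mul_zero, zero_mul]
      rw [Finset.sum_eq_zero fun a ha => Finset.sum_eq_zero fun r _ => hz c₁ hc₂ a ha r _,
        Finset.sum_eq_zero fun a ha => Finset.sum_eq_zero fun r _ => hz c₁' hc₂' a ha r _]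
    · -- `q ∥ k`: the orbit decomposition
      obtain ⟨k', rfl⟩ := hqk
      have hqk' : ¬ q ∣ k' := fun h => hqk2 (by rw [pow_two]; exact Nat.mul_dvd_mul_left q h)
      have hk' : 0 < k' := Nat.pos_of_ne_zero (by rintro rfl; exact hqk' (dvd_zero q))
      have hkq : q * k' / q = k' := Nat.mul_div_cancel_left k' hq.pos
      subst hN
      refine sum_coprime_sum_filter_classWeightedSum_mul_mul_eq hq hq2 hqk' hv D₁ hD₂ D₃ hm r₃ W₁ W₂ W₃
        (fun a r => distInt ((r : ℝ) / ((q * N₁ : ℕ) : ℝ) - (a : ℝ) / ((q * k' : ℕ) : ℝ)) ≤ ρ) ?_ ?_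
        hc₁ hc₂ hc₁' hc₂'
      · intro a ha i hi r hr
        have hlt : a + i * k' < q * k' := by nlinarith
        have h := hW (dvd_mul_right q k') (a) (by nlinarith) r hr i hi
        rw [hkq, Nat.mod_eq_of_lt hlt] at h
        exact h
      · intro a _ i _ r hr
        have hN₁ : 0 < N₁ := Nat.pos_of_ne_zero (by rintro rfl; simp at hr)
        rw [distInt_shift_eq hq.pos hk' hN₁ a r i]
  · exact Finset.sum_congr rfl fun a ha => Finset.sum_congr rfl fun r _ =>
      classWeightedSum_mul_mul_conj_eq_of_not_dvd hq hq2 hqk hv D₁ hD₂ D₃ (W₁ a r) (W₂ a r) (W₃ a r) hm r₃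
        hc₁ hc₂ hc₁' hc₂' (Finset.mem_range.mp (Finset.mem_filter.mp ha).1) (Finset.mem_filter.mp ha).2

/-! ### The telescoping bound -/

/-- **Telescoping bound for a conjugated triple product.** If `‖V_i − P_i‖ ≤ E_i` (`i = 1, 2, 3`), `‖P₁‖ ≤ B₁`,
`‖V₂‖, ‖P₂‖ ≤ B₂` and `‖V₃‖ ≤ B₃`, then `‖V₁V₂V̄₃ − P₁P₂P̄₃‖ ≤ E₁B₂B₃ + B₁E₂B₃ + B₁B₂E₃`
(`V₁V₂V̄₃ − P₁P₂P̄₃ = (V₁−P₁)V₂V̄₃ + P₁(V₂−P₂)V̄₃ + P₁P₂(V̄₃ − P̄₃)`, `‖z̄‖ = ‖z‖`). [folklore] -/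
theorem norm_triple_conj_sub_le {V₁ V₂ V₃ P₁ P₂ P₃ : ℂ} {E₁ E₂ E₃ B₁ B₂ B₃ : ℝ} (h₁ : ‖V₁ - P₁‖ ≤ E₁)
    (h₂ : ‖V₂ - P₂‖ ≤ E₂) (h₃ : ‖V₃ - P₃‖ ≤ E₃) (hP₁ : ‖P₁‖ ≤ B₁) (hV₂ : ‖V₂‖ ≤ B₂) (hP₂ : ‖P₂‖ ≤ B₂)
    (hV₃ : ‖V₃‖ ≤ B₃) :
    ‖V₁ * V₂ * starRingEnd ℂ V₃ - P₁ * P₂ * starRingEnd ℂ P₃‖ ≤ E₁ * B₂ * B₃ + B₁ * E₂ * B₃ + B₁ * B₂ * E₃ := by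
  have hid : V₁ * V₂ * starRingEnd ℂ V₃ - P₁ * P₂ * starRingEnd ℂ P₃ =
      (V₁ - P₁) * V₂ * starRingEnd ℂ V₃ + P₁ * (V₂ - P₂) * starRingEnd ℂ V₃ +
        P₁ * P₂ * starRingEnd ℂ (V₃ - P₃) := by
    rw [map_sub]; ring
  have hB₁ : 0 ≤ B₁ := (norm_nonneg _).trans hP₁
  have hB₂ : 0 ≤ B₂ := (norm_nonneg _).trans hV₂
  have hE₁ : 0 ≤ E₁ := (norm_nonneg _).trans h₁
  have hE₂ : 0 ≤ E₂ := (norm_nonneg _).trans h₂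
  have t1 : ‖(V₁ - P₁) * V₂ * starRingEnd ℂ V₃‖ ≤ E₁ * B₂ * B₃ := by
    rw [norm_mul, norm_mul, Complex.norm_conj]
    exact mul_le_mul (mul_le_mul h₁ hV₂ (norm_nonneg _) hE₁) hV₃ (norm_nonneg _) (mul_nonneg hE₁ hB₂)
  have t2 : ‖P₁ * (V₂ - P₂) * starRingEnd ℂ V₃‖ ≤ B₁ * E₂ * B₃ := by
    rw [norm_mul, norm_mul, Complex.norm_conj]
    exact mul_le_mul (mul_le_mul hP₁ h₂ (norm_nonneg _) hB₁) hV₃ (norm_nonneg _) (mul_nonneg hB₁ hE₂)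
  have t3 : ‖P₁ * P₂ * starRingEnd ℂ (V₃ - P₃)‖ ≤ B₁ * B₂ * E₃ := by
    rw [norm_mul, norm_mul, Complex.norm_conj]
    exact mul_le_mul (mul_le_mul hP₁ hP₂ (norm_nonneg _) hB₁) h₃ (norm_nonneg _) (mul_nonneg hB₁ hB₂)
  rw [hid]
  exact (norm_add₃_le ..).trans (add_le_add_three t1 t2 t3)

end SmoothArcs

end Literature.NumberTheory.Sieve

end
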